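import Literature.MathematicalPhysics.QuantumFieldTheory.BalabanImbrieJaffe1984to88.BIJ88Sect5Statements
import Mathlib.Analysis.SpecialFunctions.Pow.Deriv

/-!
# `BalabanImbrieJaffe1984to88.BIJ88ChiTDeriv309` — T. Bałaban, J. Imbrie, A. Jaffe, *Effective action and cluster properties of the
abelian Higgs model*, Commun. Math. Phys. **114** (1988) 257–315 [BalabanImbrieJaffe1988]: the **t-derivative of an interpolated
χ-factor**, p. 309 [PDF 53] (Sect. 5.14, the decoupling expansion) — *"Each t-derivative of a χ-factor in χ_{Λ₁₂^{(k)},t} gives at least a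
factor e^β(L^kε/ε₀)^{1/4−α}. This follows because with χ′(1,x) ≡ d/dx χ(1,x), we have
|d/dt χ(cp(te_k), A^{(k)})| = |A^{(k)}/(cp(te_k)²) (d/dt p(te_k)) χ′(1, A^{(k)}/cp(te_k))| ≤ ct^{−1}|χ′(1, A^{(k)}/cp(te_k))|,
and similarly the n-th derivative in t of χ(cp(e_k), A^{(k)}) is bounded by t^{−n} times a function bounded by a constant and supported
in c₁p(te_k) ≤ |A^{(k)}| ≤ c₂p(te_k)."* — PROVED (the displayed first-derivative identity, its bound, and the support clause) as real
analysis ON THE CELL'S OBJECTS: the cutoff (5.2.3)/(5.2.4) `BIJ88Sect5Statements.CutoffProfile` / `cutoff` (χ(p,x) = χ(1,x/p), χ(1,·) even,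
C^∞, = 1 on |x| ≤ 9/10, = 0 on |x| ≥ 1; r16) and the logarithmic scale (2.33) `BIJ88Sect2Statements.pLog` (p(e) = |log e⁻¹|^p; r18).

statement-level skeleton of published theorems with citation tags; proofs where landed; nothing here is a claim about the Yang–Mills mass gap

PDF held: `paper:balaban1988-cmp114-bij-abelian-higgs-effective-action` (journal page = PDF page + 256).  Page read as image: PDF p. 53
(journal 309), `g4png.py` ×2 render (seat folder `renders/original-p053-x2.png`).

CITATION HEADER (lean-in-tree rule).  Part of the lit-balaban TYPED SKELETON (HOME `run/shared/lean/pub/lit-balaban/`), Phase 2,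
seat p36 (gen 4, unit `lit-balaban-p36`); row **C2.Eq5.14.3-5.14.4** of `HOME/lit-balaban-r16/ROWS-C2-part2.md` (the row's typed leaf is
(5.14.4) `BIJ88Sect5StatementsPart2.Ineq5144`; this file kernel-checks the displayed calculus step of its proof sketch).  WHAT IS REPRODUCED
(theorem-only; no new definitions, no `Prop` facts; axioms standard), for `0 < t`, `0 < e_k`, `t·e_k < 1`, `c ≠ 0`, real `A`:
* `pLog_eq_rpow_neg_log`: on `0 < x < 1`, `p(x) = (−log x)^p`; `hasDerivAt_pLog_scale`: **`d/dt p(te_k) = −p·(−log(te_k))^{p−1}/t`**;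
* `hasDerivAt_cutoff_t`: **`d/dt χ(c·p(te_k), A) = χ′(1, A/(c·p(te_k))) · (−A/(c·p(te_k)²)) · d/dt p(te_k)`** (chain rule; χ′(1,·) = `deriv χ.χ₁`),
  hence the printed equality of absolute values `abs_deriv_cutoff_t_eq`;
* `abs_deriv_cutoff_t_le`: **`|d/dt χ(c·p(te_k), A)| ≤ (p/(t·log(1/(te_k))))·|χ′(1, A/(c·p(te_k)))| ≤ (p/t)·|χ′(1, A/(c·p(te_k)))|`** for
  `te_k ≤ e^{−1}` — the printed `ct^{−1}` with `c = p`, the exponent of (2.33) (mechanism: `|p′|/p = p/(t log(1/(te_k)))`, and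
  `|A|/(|c|p(te_k)) ≤ 1` wherever `χ′(1, ·) ≠ 0`);
* `deriv_chi1_eq_zero_of_lt` / `_of_gt` and `support_deriv_cutoff_t`: the support clause — `χ′(1,x) ≠ 0 ⇒ 9/10 ≤ |x| ≤ 1`, so the t-derivative
  vanishes unless `(9/10)|c|·p(te_k) ≤ |A| ≤ |c|·p(te_k)` (the printed `c₁p(te_k) ≤ |A^{(k)}| ≤ c₂p(te_k)` with `c₁ = 9c/10`, `c₂ = c`).
NOT here: the n-th derivative sentence (Faà di Bruno), the Gaussian-integration consequence *"ct^{−n}e^{−cp(te_k)²} ≤ (e^β(L^kε/ε₀)^{1/4−α})ⁿ"*,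
(5.14.3)–(5.14.4) themselves.
-/

namespace Literature.MathematicalPhysics.QuantumFieldTheory.BalabanImbrieJaffe1984to88.BIJ88ChiTDeriv309

open BIJ88Sect2Statements (pLog)
open BIJ88Sect5Statements (CutoffProfile cutoff)

/-! ## §1 The logarithmic scale along `t ↦ t·e_k` -/

section PLog

/-- (2.33) on the small-argument branch: for `0 < x < 1`, `p(x) = |log x⁻¹|^p = (−log x)^p`. [cite: BalabanImbrieJaffe1988, (2.33) p.263] -/
theorem pLog_eq_rpow_neg_log (p : ℝ) {x : ℝ} (hx0 : 0 < x) (hx1 : x < 1) : pLog p x = (-Real.log x) ^ p := by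
  unfold pLog
  have hneg : Real.log x < 0 := Real.log_neg hx0 hx1
  rw [Real.log_inv, abs_of_pos (by linarith)]

/-- **`d/dt p(te_k) = −p·(−log(te_k))^{p−1}/t`** for `0 < t`, `0 < e_k`, `te_k < 1` (p. 309: the factor *"(d/dt p(te_k))"*).
[cite: BalabanImbrieJaffe1988, (5.14.4) p.309] -/
theorem hasDerivAt_pLog_scale (p : ℝ) {t ek : ℝ} (ht : 0 < t) (hek : 0 < ek) (h1 : t * ek < 1) :
    HasDerivAt (fun s => pLog p (s * ek)) (-(p * (-Real.log (t * ek)) ^ (p - 1)) / t) t := by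
  have htek : 0 < t * ek := mul_pos ht hek
  have hL : 0 < -Real.log (t * ek) := by have := Real.log_neg htek h1; linarith
  -- g(s) = −log(s e_k), g′(t) = −1/t
  have hg : HasDerivAt (fun s => -Real.log (s * ek)) (-(ek / (t * ek))) t := by
    have hm : HasDerivAt (fun s => s * ek) ek t := by simpa using (hasDerivAt_id t).mul_const ek
    exact (hm.log htek.ne').neg
  -- h(s) = g(s)^p
  have hh : HasDerivAt (fun s => (-Real.log (s * ek)) ^ p) (-(ek / (t * ek)) * p * (-Real.log (t * ek)) ^ (p - 1)) t :=
    hg.rpow_const (Or.inl hL.ne')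
  -- transfer to pLog on a neighbourhood where 0 < s e_k < 1
  have hev : (fun s => pLog p (s * ek)) =ᶠ[nhds t] fun s => (-Real.log (s * ek)) ^ p := by
    have hopen : IsOpen {s : ℝ | 0 < s ∧ s * ek < 1} :=
      (isOpen_lt continuous_const continuous_id).inter (isOpen_lt (continuous_id.mul continuous_const) continuous_const)
    filter_upwards [hopen.mem_nhds ⟨ht, h1⟩] with s hs
    exact pLog_eq_rpow_neg_log p (mul_pos hs.1 hek) hs.2
  refine (hh.congr_of_eventuallyEq hev).congr_deriv ?_
  have : ek / (t * ek) = 1 / t := by rw [mul_comm, ← div_div, div_self hek.ne']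
  rw [this]
  ring

end PLog

/-! ## §2 The t-derivative of `χ(c·p(te_k), A)` -/

section Deriv

variable (χ : CutoffProfile)

/-- χ(1, ·) is differentiable (from *"C^∞"* in (5.2.3)). [cite: BalabanImbrieJaffe1988, (5.2.3) p.278] -/
theorem hasDerivAt_chi1 (x : ℝ) : HasDerivAt χ.χ₁ (deriv χ.χ₁ x) x :=
  ((χ.smooth.differentiable (by simp)).differentiableAt).hasDerivAt

/-- **The chain rule of p. 309**: for `0 < t`, `0 < e_k`, `te_k < 1`, `c ≠ 0`,
`d/dt χ(c·p(te_k), A) = χ′(1, A/(c·p(te_k))) · (−A/(c·p(te_k)²) · d/dt p(te_k))`, `χ′(1,·) = deriv χ(1,·)`, `d/dt p(te_k)` from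
`hasDerivAt_pLog_scale`. [cite: BalabanImbrieJaffe1988, (5.14.4) p.309] -/
theorem hasDerivAt_cutoff_t (p : ℝ) {t ek c : ℝ} (ht : 0 < t) (hek : 0 < ek) (h1 : t * ek < 1) (hc : c ≠ 0) (A : ℝ) :
    HasDerivAt (fun s => cutoff χ (c * pLog p (s * ek)) A)
      (deriv χ.χ₁ (A / (c * pLog p (t * ek))) *
        (-(A / (c * pLog p (t * ek) ^ 2)) * (-(p * (-Real.log (t * ek)) ^ (p - 1)) / t))) t := by
  have htek : 0 < t * ek := mul_pos ht hek
  have hL : 0 < -Real.log (t * ek) := by have := Real.log_neg htek h1; linarith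
  have hP : 0 < pLog p (t * ek) := by rw [pLog_eq_rpow_neg_log p htek h1]; exact Real.rpow_pos_of_pos hL p
  have hu := hasDerivAt_pLog_scale p ht hek h1
  -- v(s) = A / (c p(s e_k)) = (A/c) · (p(s e_k))⁻¹
  have hv : HasDerivAt (fun s => A / (c * pLog p (s * ek)))
      (A / c * (-(-(p * (-Real.log (t * ek)) ^ (p - 1)) / t) / pLog p (t * ek) ^ 2)) t := by
    have hinv := hu.inv hP.ne'
    have := hinv.const_mul (A / c)
    refine this.congr_of_eventuallyEq (Filter.Eventually.of_forall fun s => ?_)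
    show A / (c * pLog p (s * ek)) = A / c * (pLog p (s * ek))⁻¹
    rw [div_mul_eq_div_div, div_eq_mul_inv]
  have hcomp := (hasDerivAt_chi1 χ (A / (c * pLog p (t * ek)))).comp t hv
  have heq : (fun s => cutoff χ (c * pLog p (s * ek)) A) = χ.χ₁ ∘ fun s => A / (c * pLog p (s * ek)) := by
    funext s; rfl
  rw [heq]
  refine hcomp.congr_deriv ?_
  field_simp

/-- **The printed identity of absolute values** p. 309:
`|d/dt χ(cp(te_k), A)| = |A/(cp(te_k)²) · (d/dt p(te_k)) · χ′(1, A/cp(te_k))|`. [cite: BalabanImbrieJaffe1988, (5.14.4) p.309] -/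
theorem abs_deriv_cutoff_t_eq (p : ℝ) {t ek c : ℝ} (ht : 0 < t) (hek : 0 < ek) (h1 : t * ek < 1) (hc : c ≠ 0) (A : ℝ) :
    |deriv (fun s => cutoff χ (c * pLog p (s * ek)) A) t| =
      |A / (c * pLog p (t * ek) ^ 2) * deriv (fun s => pLog p (s * ek)) t * deriv χ.χ₁ (A / (c * pLog p (t * ek)))| := by
  rw [(hasDerivAt_cutoff_t χ p ht hek h1 hc A).deriv, (hasDerivAt_pLog_scale p ht hek h1).deriv]
  rw [show deriv χ.χ₁ (A / (c * pLog p (t * ek))) *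
      (-(A / (c * pLog p (t * ek) ^ 2)) * (-(p * (-Real.log (t * ek)) ^ (p - 1)) / t)) =
      A / (c * pLog p (t * ek) ^ 2) * (-(p * (-Real.log (t * ek)) ^ (p - 1)) / t) * deriv χ.χ₁ (A / (c * pLog p (t * ek))) * (-1)
      by ring, abs_mul, abs_neg, abs_one, mul_one]

/-- the support of χ′(1,·), lower side: χ(1,x) = 1 near every |x| < 9/10, so χ′(1,x) = 0 there. [cite: BalabanImbrieJaffe1988, (5.2.3) p.278] -/
theorem deriv_chi1_eq_zero_of_lt {x : ℝ} (hx : |x| < 9 / 10) : deriv χ.χ₁ x = 0 := by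
  have hev : χ.χ₁ =ᶠ[nhds x] fun _ => (1 : ℝ) := by
    have hopen : IsOpen {y : ℝ | |y| < 9 / 10} := isOpen_lt continuous_abs continuous_const
    filter_upwards [hopen.mem_nhds hx] with y hy
    exact χ.eq_one y hy.le
  rw [hev.deriv_eq, deriv_const]

/-- the support of χ′(1,·), upper side: χ(1,x) = 0 near every |x| > 1, so χ′(1,x) = 0 there. [cite: BalabanImbrieJaffe1988, (5.2.3) p.278] -/
theorem deriv_chi1_eq_zero_of_gt {x : ℝ} (hx : 1 < |x|) : deriv χ.χ₁ x = 0 := by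
  have hev : χ.χ₁ =ᶠ[nhds x] fun _ => (0 : ℝ) := by
    have hopen : IsOpen {y : ℝ | 1 < |y|} := isOpen_lt continuous_const continuous_abs
    filter_upwards [hopen.mem_nhds hx] with y hy
    exact χ.eq_zero y hy.le
  rw [hev.deriv_eq, deriv_const]

/-- `χ′(1,x) ≠ 0 ⇒ 9/10 ≤ |x| ≤ 1`. [cite: BalabanImbrieJaffe1988, (5.2.3) p.278] -/
theorem abs_mem_of_deriv_chi1_ne_zero {x : ℝ} (hx : deriv χ.χ₁ x ≠ 0) : 9 / 10 ≤ |x| ∧ |x| ≤ 1 := by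
  constructor
  · by_contra h
    exact hx (deriv_chi1_eq_zero_of_lt χ (not_le.mp h))
  · by_contra h
    exact hx (deriv_chi1_eq_zero_of_gt χ (not_le.mp h))

/-- **The printed bound** p. 309: for `0 < t`, `0 < e_k`, `te_k < 1`, `c ≠ 0`:
`|d/dt χ(cp(te_k), A)| ≤ (p/(t·log(1/(te_k))))·|χ′(1, A/cp(te_k))|` — MECHANISM: `|d/dt p(te_k)|/p(te_k) = |p|/(t·log(1/(te_k)))` and
`|A|/(|c|p(te_k)) ≤ 1` wherever `χ′(1, A/cp(te_k)) ≠ 0`. [cite: BalabanImbrieJaffe1988, (5.14.4) p.309] -/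
theorem abs_deriv_cutoff_t_le_log (p : ℝ) {t ek c : ℝ} (ht : 0 < t) (hek : 0 < ek) (h1 : t * ek < 1) (hc : c ≠ 0) (A : ℝ) :
    |deriv (fun s => cutoff χ (c * pLog p (s * ek)) A) t| ≤
      |p| / (t * (-Real.log (t * ek))) * |deriv χ.χ₁ (A / (c * pLog p (t * ek)))| := by
  have htek : 0 < t * ek := mul_pos ht hek
  have hL : 0 < -Real.log (t * ek) := by have := Real.log_neg htek h1; linarith
  set P := pLog p (t * ek) with hPdef
  have hPeq : P = (-Real.log (t * ek)) ^ p := pLog_eq_rpow_neg_log p htek h1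
  have hP : 0 < P := by rw [hPeq]; exact Real.rpow_pos_of_pos hL p
  set v := A / (c * P) with hv
  rw [(hasDerivAt_cutoff_t χ p ht hek h1 hc A).deriv]
  by_cases hχ : deriv χ.χ₁ v = 0
  · rw [hχ, zero_mul, abs_zero]; positivity
  · have hv1 : |v| ≤ 1 := (abs_mem_of_deriv_chi1_ne_zero χ hχ).2
    -- |A/(cP²) · (p g^{p-1}/t)| = |v| · (|p| g^{p-1}/(t P)) = |v| · |p|/(t g)
    have hgp : (-Real.log (t * ek)) ^ (p - 1) = P / (-Real.log (t * ek)) := by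
      rw [hPeq, Real.rpow_sub_one hL.ne']
    have key : |-(A / (c * P ^ 2)) * (-(p * (-Real.log (t * ek)) ^ (p - 1)) / t)| =
        |v| * (|p| / (t * (-Real.log (t * ek)))) := by
      have hreal : -(A / (c * P ^ 2)) * (-(p * (-Real.log (t * ek)) ^ (p - 1)) / t) =
          v * (p / (t * (-Real.log (t * ek)))) := by
        rw [hgp, hv]
        field_simp
      rw [hreal, abs_mul v, abs_div p, abs_mul t, abs_of_pos ht, abs_of_pos hL]
    rw [abs_mul, key]
    calc |deriv χ.χ₁ v| * (|v| * (|p| / (t * (-Real.log (t * ek)))))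
        ≤ |deriv χ.χ₁ v| * (1 * (|p| / (t * (-Real.log (t * ek))))) := by
          refine mul_le_mul_of_nonneg_left (mul_le_mul_of_nonneg_right hv1 (by positivity)) (abs_nonneg _)
      _ = |p| / (t * (-Real.log (t * ek))) * |deriv χ.χ₁ v| := by ring

/-- **`|d/dt χ(cp(te_k), A)| ≤ (p/t)·|χ′(1, A/cp(te_k))|` for `te_k ≤ e^{−1}`** (so `log(1/(te_k)) ≥ 1`), `p ≥ 0`: the printed
`≤ ct^{−1}|χ′(1, A^{(k)}/cp(te_k))|` with the constant = the exponent `p` of (2.33). [cite: BalabanImbrieJaffe1988, (5.14.4) p.309] -/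
theorem abs_deriv_cutoff_t_le {p t ek c : ℝ} (hp : 0 ≤ p) (ht : 0 < t) (hek : 0 < ek) (h1 : t * ek ≤ Real.exp (-1)) (hc : c ≠ 0)
    (A : ℝ) :
    |deriv (fun s => cutoff χ (c * pLog p (s * ek)) A) t| ≤ p / t * |deriv χ.χ₁ (A / (c * pLog p (t * ek)))| := by
  have htek : 0 < t * ek := mul_pos ht hek
  have h1' : t * ek < 1 := h1.trans_lt (by rw [← Real.exp_zero]; exact Real.exp_lt_exp.mpr (by norm_num))
  have hL1 : 1 ≤ -Real.log (t * ek) := by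
    have := Real.log_le_log htek h1
    rw [Real.log_exp] at this
    linarith
  refine (abs_deriv_cutoff_t_le_log χ p ht hek h1' hc A).trans ?_
  rw [abs_of_nonneg hp]
  refine mul_le_mul_of_nonneg_right ?_ (abs_nonneg _)
  rw [div_le_div_iff₀ (by positivity) ht]
  nlinarith [mul_nonneg (mul_nonneg hp ht.le) (sub_nonneg.mpr hL1)]

/-- **The support clause** p. 309 (*"supported in c₁p(te_k) ≤ |A^{(k)}| ≤ c₂p(te_k)"*): the t-derivative vanishes unless
`(9/10)|c|·p(te_k) ≤ |A| ≤ |c|·p(te_k)`. [cite: BalabanImbrieJaffe1988, (5.14.4) p.309] -/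
theorem support_deriv_cutoff_t (p : ℝ) {t ek c : ℝ} (ht : 0 < t) (hek : 0 < ek) (h1 : t * ek < 1) (hc : c ≠ 0) {A : ℝ}
    (hne : deriv (fun s => cutoff χ (c * pLog p (s * ek)) A) t ≠ 0) :
    9 / 10 * (|c| * pLog p (t * ek)) ≤ |A| ∧ |A| ≤ |c| * pLog p (t * ek) := by
  have htek : 0 < t * ek := mul_pos ht hek
  have hL : 0 < -Real.log (t * ek) := by have := Real.log_neg htek h1; linarith
  have hP : 0 < pLog p (t * ek) := by rw [pLog_eq_rpow_neg_log p htek h1]; exact Real.rpow_pos_of_pos hL p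
  have hcP : 0 < |c| * pLog p (t * ek) := mul_pos (abs_pos.mpr hc) hP
  rw [(hasDerivAt_cutoff_t χ p ht hek h1 hc A).deriv] at hne
  have hχ : deriv χ.χ₁ (A / (c * pLog p (t * ek))) ≠ 0 := fun h => hne (by rw [h, zero_mul])
  obtain ⟨hlo, hhi⟩ := abs_mem_of_deriv_chi1_ne_zero χ hχ
  rw [abs_div, abs_mul, abs_of_pos hP] at hlo hhi
  exact ⟨by rwa [le_div_iff₀ hcP] at hlo, by rwa [div_le_iff₀ hcP, one_mul] at hhi⟩

end Deriv

end Literature.MathematicalPhysics.QuantumFieldTheory.BalabanImbrieJaffe1984to88.BIJ88ChiTDeriv309
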